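import Literature.Probability.RandomPlanarGeometry.HexSAWStripWidthTwoContactChernoff
import HarnessLib

/-!
# The width-two strip at criticality: the GAUSSIAN EXPONENT of the contact count —
# `(log λ − φ₃·log(y(λ)/y₂)) / log(y(λ)/y₂)² → σ₂² = (96 − 67√2)/8` as the Perron root `λ → 1`
# (module «WIDTH-TWO GAUSSIAN EXPONENT»; brick 3 of the contact CLT programme)

Topic `Literature/Probability/RandomPlanarGeometry` (continues «WIDTH-TWO CONTACT CHERNOFF BOUNDS» — the Perron parametrisation `W2.yOfLam`,
`W2.yOfLam_one`, `W2.yOfLam_facts`, `W2.lamQuad_pos` — and «WIDTH-TWO CONTACT VARIANCE RATE» — `W2.phiTwo_three_eq` (`φ₃ = ½ + x²`), `sqrt_two_eq`,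
`xc_minpoly`).  Lane «pcv-sawmu» (CriticalPhenomena venture), a-p2 g27.  Setting: for the moment generating function `M_k(s) = D̂(k; y₂eˢ)/D̂(k; y₂)`
of the contact count `#top` of a bridge of hat index `k`, the tilt `s` and the Perron root `λ` of `G(y₂eˢ)` are tied by `s = S(λ) := log(y(λ)/y₂)`;
the standardised variable `(#top − φ₃k)/√k` at `s_k = t/√k` has `log`-MGF `k·log λ_k − φ₃t√k + O(1) = t²·(log λ_k − φ₃S(λ_k))/S(λ_k)² + O(1)`,
so the Gaussian limit `e^{σ²t²/2}` is EXACTLY the statement that `(log λ − φ₃S(λ))/S(λ)² → σ²/2` as `λ → 1` (W. Feller II (1971) XVI / Curtiss 1942 for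
the MGF route; W. Feller I (1968) XIII.6 for the renewal setting; R. P. Stanley EC1 §4.1).  This file proves that limit, with the value `σ₂² = (96 − 67√2)/8` —
the variance rate of «WIDTH-TWO CONTACT VARIANCE RATE», obtained there from the second-order renewal asymptotics, reappears here as the curvature of the
Perron root: an independent confirmation inside the tree.  Nothing below is printed.

## What is proved (namespace `…SAW.HV.W2`, `x = x_c`)

§1 `tiltLog λ = log y(λ) − log y₂`, `tiltLogD`, `tiltLogDD` (explicit `S′`, `S″`), `log_yOfLam_eq` (`log y(λ) = 2 log λ + log(λ − x²) − log x² −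
log(λ² − x²λ + x⁴)`, `λ > x²`), ★ `hasDerivAt_tiltLog`, ★ `hasDerivAt_tiltLogD` (on `λ > x²`), ★ `tiltLog_one` (`S(1) = 0`, `S′(1) = 2/(1 + 2x²) = 1/φ₃`),
`tiltLog_ne_zero` (`λ ≠ 1`).
§2 ★★★ **`tendsto_gaussExponent`**: `Tendsto (fun λ => (log λ − phiTwo 3·tiltLog λ)/tiltLog λ²) (𝓝[≠] 1) (𝓝 ((96 − 67√2)/8))` — l'Hôpital twice
(`HasDerivAt.lhopital_zero_nhdsNE`) on the explicit `S, S′, S″`, the value being the algebraic identity `(−1 − φ₃S″(1))/(2S′(1)²) = (96 − 67√2)/8` modulo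
`2x⁴ − 4x² + 1 = 0` (one `linear_combination` certificate with `field_simp` normalisation).

Numerics (kit `HOME/pub-sawmu-a-p2/g27/gexp/gen_gexp.py`): `S′(1) = 1.2612039 = (6 + 2√2)/7`, `S″(1) = −1.8869570`, and the difference quotient
`(log λ − φ₃S(λ))/S(λ)²` at `λ = 1 + 10⁻⁴` equals `0.1559560` vs `σ₂² = 0.1559614`.
Label: LANE THEOREM (own result of lane «pcv-sawmu», a-p2 g27, 2026-08-28; not in print).  NOT claimed (next bricks): the existence and continuity of the
inverse tilt `λ(s)` with `|λ(s) − 1| = O(|s|)`, the uniform deflation bound near `λ = 1`, the MGF asymptotics and the CLT via Curtiss' theorem.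
-/

noncomputable section

open Finset Filter Topology Matrix Literature.Probability.LatticeModels Literature.Probability.Percolation Literature.Analysis

namespace Literature.Probability.RandomPlanarGeometry.SAW

namespace HV

namespace W2

/-! ## §1 The tilt `S(λ) = log(y(λ)/y₂)` and its first two derivatives -/

/-- The logarithmic tilt `S(λ) = log(y(λ)/y₂) = log y(λ) − log y₂`: the contact-fugacity parameter `s` (`y = y₂eˢ`) of the Perron root `λ`.
[cite: Feller1968, XIII.6; lane «pcv-sawmu» a-p2 g27] -/
def tiltLog (lam : ℝ) : ℝ := Real.log (yOfLam lam) - Real.log (stripYT 2)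

/-- `S′(λ) = 2/λ + 1/(λ − x²) − (2λ − x²)/(λ² − x²λ + x⁴)`. [cite: Feller1968, XIII.6; lane «pcv-sawmu» a-p2 g27] -/
def tiltLogD (lam : ℝ) : ℝ :=
  2 / lam + 1 / (lam - hexCriticalFugacity ^ 2) - (2 * lam - hexCriticalFugacity ^ 2) / (lam ^ 2 - hexCriticalFugacity ^ 2 * lam + hexCriticalFugacity ^ 4)

/-- `S″(λ) = −2/λ² − 1/(λ − x²)² − (2(λ² − x²λ + x⁴) − (2λ − x²)²)/(λ² − x²λ + x⁴)²`. [cite: Feller1968, XIII.6; lane «pcv-sawmu» a-p2 g27] -/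
def tiltLogDD (lam : ℝ) : ℝ :=
  -2 / lam ^ 2 - 1 / (lam - hexCriticalFugacity ^ 2) ^ 2
    - (2 * (lam ^ 2 - hexCriticalFugacity ^ 2 * lam + hexCriticalFugacity ^ 4) - (2 * lam - hexCriticalFugacity ^ 2) ^ 2)
      / (lam ^ 2 - hexCriticalFugacity ^ 2 * lam + hexCriticalFugacity ^ 4) ^ 2

/-- `log y(λ) = 2 log λ + log(λ − x²) − log x² − log(λ² − x²λ + x⁴)` for `λ > x²`. [cite: Seneta1973, §1.4; lane plumbing] -/
theorem log_yOfLam_eq {lam : ℝ} (h : hexCriticalFugacity ^ 2 < lam) :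
    Real.log (yOfLam lam) = 2 * Real.log lam + Real.log (lam - hexCriticalFugacity ^ 2) - Real.log (hexCriticalFugacity ^ 2)
      - Real.log (lam ^ 2 - hexCriticalFugacity ^ 2 * lam + hexCriticalFugacity ^ 4) := by
  have hx : 0 < hexCriticalFugacity := hexCriticalFugacity_pos_lt_one.1
  have hl : 0 < lam := lt_trans (by positivity) h
  have hq := lamQuad_pos lam
  rw [yOfLam, Real.log_div (mul_pos (by positivity) (by linarith)).ne' (mul_pos (by positivity) hq).ne',
    Real.log_mul (by positivity) (by linarith : lam - hexCriticalFugacity ^ 2 ≠ 0), Real.log_mul (by positivity) hq.ne', Real.log_pow]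
  push_cast
  ring

/-- `S` has derivative `S′` at every `λ > x²`. [cite: Feller1968, XIII.6; lane plumbing] -/
theorem hasDerivAt_tiltLog {lam : ℝ} (h : hexCriticalFugacity ^ 2 < lam) : HasDerivAt tiltLog (tiltLogD lam) lam := by
  have hx : 0 < hexCriticalFugacity := hexCriticalFugacity_pos_lt_one.1
  have hl : 0 < lam := lt_trans (by positivity) h
  have hq := lamQuad_pos lam
  -- work with the log-sum form on the open set `(x², ∞)`
  have hev : ∀ᶠ mu in 𝓝 lam, tiltLog mu = 2 * Real.log mu + Real.log (mu - hexCriticalFugacity ^ 2) - Real.log (hexCriticalFugacity ^ 2)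
      - Real.log (mu ^ 2 - hexCriticalFugacity ^ 2 * mu + hexCriticalFugacity ^ 4) - Real.log (stripYT 2) := by
    filter_upwards [eventually_gt_nhds h] with mu hmu
    rw [tiltLog, log_yOfLam_eq hmu]
  have hd : HasDerivAt (fun mu : ℝ => 2 * Real.log mu + Real.log (mu - hexCriticalFugacity ^ 2) - Real.log (hexCriticalFugacity ^ 2)
      - Real.log (mu ^ 2 - hexCriticalFugacity ^ 2 * mu + hexCriticalFugacity ^ 4) - Real.log (stripYT 2))
      (2 * lam⁻¹ + 1 / (lam - hexCriticalFugacity ^ 2) - (((2 : ℕ) : ℝ) * lam ^ (2 - 1) * 1 - hexCriticalFugacity ^ 2 * 1)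
        / (lam ^ 2 - hexCriticalFugacity ^ 2 * lam + hexCriticalFugacity ^ 4)) lam := by
    have h1 : HasDerivAt (fun mu : ℝ => 2 * Real.log mu) (2 * lam⁻¹) lam := (Real.hasDerivAt_log hl.ne').const_mul 2
    have h2 : HasDerivAt (fun mu : ℝ => Real.log (mu - hexCriticalFugacity ^ 2)) (1 / (lam - hexCriticalFugacity ^ 2)) lam := by
      have := ((hasDerivAt_id lam).sub_const (hexCriticalFugacity ^ 2)).log (by simp only [id]; linarith)
      simpa using this
    have h3 : HasDerivAt (fun mu : ℝ => Real.log (mu ^ 2 - hexCriticalFugacity ^ 2 * mu + hexCriticalFugacity ^ 4))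
        ((((2 : ℕ) : ℝ) * lam ^ (2 - 1) * 1 - hexCriticalFugacity ^ 2 * 1) / (lam ^ 2 - hexCriticalFugacity ^ 2 * lam + hexCriticalFugacity ^ 4)) lam :=
      ((((hasDerivAt_id lam).pow 2).sub ((hasDerivAt_id lam).const_mul _)).add_const _).log (by simp only [id]; exact hq.ne')
    exact ((h1.add h2).sub_const _).sub h3 |>.sub_const _
  refine (hd.congr_of_eventuallyEq hev).congr_deriv ?_
  rw [tiltLogD]
  push_cast
  ring

/-- `S′` has derivative `S″` at every `λ > x²`. [cite: Feller1968, XIII.6; lane plumbing] -/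
theorem hasDerivAt_tiltLogD {lam : ℝ} (h : hexCriticalFugacity ^ 2 < lam) : HasDerivAt tiltLogD (tiltLogDD lam) lam := by
  have hx : 0 < hexCriticalFugacity := hexCriticalFugacity_pos_lt_one.1
  have hl : 0 < lam := lt_trans (by positivity) h
  have hq := lamQuad_pos lam
  have ha : lam - hexCriticalFugacity ^ 2 ≠ 0 := by linarith
  have h1 := (hasDerivAt_const lam (2:ℝ)).div (hasDerivAt_id lam) hl.ne'
  have h2 := (hasDerivAt_const lam (1:ℝ)).div ((hasDerivAt_id lam).sub_const (hexCriticalFugacity ^ 2)) (by simpa only [id] using ha)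
  have h3 : HasDerivAt (fun mu : ℝ => (2 * mu - hexCriticalFugacity ^ 2) / (mu ^ 2 - hexCriticalFugacity ^ 2 * mu + hexCriticalFugacity ^ 4))
      ((2 * 1 * (lam ^ 2 - hexCriticalFugacity ^ 2 * lam + hexCriticalFugacity ^ 4)
        - (2 * lam - hexCriticalFugacity ^ 2) * (((2 : ℕ) : ℝ) * lam ^ (2 - 1) * 1 - hexCriticalFugacity ^ 2 * 1))
        / (lam ^ 2 - hexCriticalFugacity ^ 2 * lam + hexCriticalFugacity ^ 4) ^ 2) lam :=
    (((hasDerivAt_id lam).const_mul 2).sub_const _).div ((((hasDerivAt_id lam).pow 2).sub ((hasDerivAt_id lam).const_mul _)).add_const _) hq.ne'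
  have e : tiltLogD = fun mu : ℝ => 2 / mu + 1 / (mu - hexCriticalFugacity ^ 2)
      - (2 * mu - hexCriticalFugacity ^ 2) / (mu ^ 2 - hexCriticalFugacity ^ 2 * mu + hexCriticalFugacity ^ 4) := rfl
  rw [e]
  refine ((h1.add h2).sub h3).congr_deriv ?_
  simp only [id]
  rw [tiltLogDD]
  push_cast
  field_simp
  ring

/-- `S(1) = 0`, `S′(1) = 2/(1 + 2x²) = 1/φ₃` («CHERNOFF BOUNDS» `yOneDerivTwo_div_stripYT_two` in the new notation). [cite: Feller1968, XIII.6; lane «pcv-sawmu» a-p2 g27] -/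
theorem tiltLog_one : tiltLog 1 = 0 ∧ tiltLogD 1 = 2 / (1 + 2 * hexCriticalFugacity ^ 2) := by
  have hP := xc_minpoly
  obtain ⟨hb1, hb2⟩ := xc_sq_bounds
  refine ⟨by rw [tiltLog, yOfLam_one, sub_self], ?_⟩
  set x := hexCriticalFugacity with hx
  have ha : (1 : ℝ) - x ^ 2 ≠ 0 := by nlinarith
  have hq : (1 : ℝ) ^ 2 - x ^ 2 * 1 + x ^ 4 ≠ 0 := by nlinarith
  have hq' : (1 : ℝ) - x ^ 2 + x ^ 4 ≠ 0 := by nlinarith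
  have ht : (1 : ℝ) + 2 * x ^ 2 ≠ 0 := by positivity
  have e : tiltLogD 1 = ((1 : ℝ) + (-2 : ℝ) * x ^ 2 + (4 : ℝ) * x ^ 4 + (-2 : ℝ) * x ^ 6) / ((1 - x ^ 2) * (1 - x ^ 2 + x ^ 4)) := by
    rw [tiltLogD, ← hx, eq_div_iff (mul_ne_zero ha hq')]
    field_simp
    ring
  rw [e, div_eq_div_iff (mul_ne_zero ha hq') ht]
  linear_combination ((-1 : ℝ) + (-2 : ℝ) * x ^ 4) * hP

/-- `S(λ) ≠ 0` for `λ ≠ 1` (`λ > x²`): `y(λ) ≷ y₂` according as `λ ≷ 1`. [cite: Seneta1973, §1.4; lane plumbing] -/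
theorem tiltLog_ne_zero {lam : ℝ} (h : hexCriticalFugacity ^ 2 < lam) (h1 : lam ≠ 1) : tiltLog lam ≠ 0 := by
  have hy2 : 0 < stripYT 2 := stripYT_pos (by norm_num)
  have hy : 0 < yOfLam lam := yOfLam_pos h
  rw [tiltLog, sub_ne_zero]
  intro heq
  have := Real.log_injOn_pos (Set.mem_Ioi.2 hy) (Set.mem_Ioi.2 hy2) heq
  rcases lt_or_gt_of_ne h1 with hlt | hgt
  · exact (yOfLam_facts.2 lam h hlt).2.ne this
  · exact (yOfLam_facts.1 lam hgt).ne' this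

/-! ## §2 The Gaussian exponent: `(log λ − φ₃·S(λ))/S(λ)² → σ̂/2 = (96 − 67√2)/8` as `λ → 1` -/

/-- ★★★ **THE GAUSSIAN EXPONENT**: `(log λ − φ₃·S(λ)) / S(λ)² → (96 − 67√2)/8 = σ̂/2 = σ₂²` as `λ → 1`, `λ ≠ 1` (`φ₃ = phiTwo 3 = ½ + x²` the mean
contact rate per hat index, `S(λ) = log(y(λ)/y₂)` the tilt).  This is the limit that turns `k·log λ_k − φ₃·t·√k` (with `S(λ_k) = t/√k`) into `σ̂t²/2` in the
moment generating function of the standardised contact count — by l'Hôpital twice on the explicit `S`, `S′`, `S″`; the value is the algebraic identity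
`(−1 − φ₃S″(1))/(2S′(1)²) = (96 − 67√2)/8` modulo `2x⁴ − 4x² + 1 = 0`: the VARIANCE RATE of «WIDTH-TWO CONTACT VARIANCE RATE» reappears as the curvature
of the Perron root.
[cite: Feller1968, XIII.6; Stanley2012EC1, §4.1; lane «pcv-sawmu» a-p2 g27 — own result, not in print] -/
theorem tendsto_gaussExponent :
    Tendsto (fun lam : ℝ => (Real.log lam - phiTwo 3 * tiltLog lam) / tiltLog lam ^ 2) (𝓝[≠] 1) (𝓝 ((96 - 67 * Real.sqrt 2) / 8)) := by
  have hP := xc_minpoly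
  obtain ⟨hb1, hb2⟩ := xc_sq_bounds
  have hx : 0 < hexCriticalFugacity := hexCriticalFugacity_pos_lt_one.1
  have hx1 : hexCriticalFugacity ^ 2 < 1 := by nlinarith
  have hφ : phiTwo 3 = 1 / 2 + hexCriticalFugacity ^ 2 := phiTwo_three_eq.1
  obtain ⟨hS1, hS1'⟩ := tiltLog_one
  -- the open set `(x², ∞)` is a neighbourhood of `1`
  have hU : ∀ᶠ lam in 𝓝 (1 : ℝ), hexCriticalFugacity ^ 2 < lam := eventually_gt_nhds hx1
  have hU0 : ∀ᶠ lam in 𝓝 (1 : ℝ), (0 : ℝ) < lam := eventually_gt_nhds one_pos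
  -- the functions and their derivatives
  set φ : ℝ := phiTwo 3 with hφdef
  set f : ℝ → ℝ := fun lam => Real.log lam - φ * tiltLog lam with hf
  set f' : ℝ → ℝ := fun lam => lam⁻¹ - φ * tiltLogD lam with hf'
  set f'' : ℝ → ℝ := fun lam => -(lam ^ 2)⁻¹ - φ * tiltLogDD lam with hf''
  set g : ℝ → ℝ := fun lam => tiltLog lam * tiltLog lam with hg
  set g' : ℝ → ℝ := fun lam => tiltLogD lam * tiltLog lam + tiltLog lam * tiltLogD lam with hg'
  set g'' : ℝ → ℝ := fun lam => (tiltLogDD lam * tiltLog lam + tiltLogD lam * tiltLogD lam)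
    + (tiltLogD lam * tiltLogD lam + tiltLog lam * tiltLogDD lam) with hg''
  have hff' : ∀ᶠ lam in 𝓝 (1 : ℝ), HasDerivAt f (f' lam) lam := by
    filter_upwards [hU, hU0] with lam hlam hl0
    exact (Real.hasDerivAt_log hl0.ne').sub ((hasDerivAt_tiltLog hlam).const_mul φ)
  have hgg' : ∀ᶠ lam in 𝓝 (1 : ℝ), HasDerivAt g (g' lam) lam := by
    filter_upwards [hU] with lam hlam
    exact (hasDerivAt_tiltLog hlam).mul (hasDerivAt_tiltLog hlam)
  have hff'' : ∀ᶠ lam in 𝓝 (1 : ℝ), HasDerivAt f' (f'' lam) lam := by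
    filter_upwards [hU, hU0] with lam hlam hl0
    exact (hasDerivAt_inv hl0.ne').sub ((hasDerivAt_tiltLogD hlam).const_mul φ)
  have hgg'' : ∀ᶠ lam in 𝓝 (1 : ℝ), HasDerivAt g' (g'' lam) lam := by
    filter_upwards [hU] with lam hlam
    exact ((hasDerivAt_tiltLogD hlam).mul (hasDerivAt_tiltLog hlam)).add ((hasDerivAt_tiltLog hlam).mul (hasDerivAt_tiltLogD hlam))
  -- continuity at `1` of `S`, `S′`, `S″`
  have cS : ContinuousAt tiltLog 1 := (hasDerivAt_tiltLog hx1).continuousAt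
  have cS' : ContinuousAt tiltLogD 1 := (hasDerivAt_tiltLogD hx1).continuousAt
  have cS'' : ContinuousAt tiltLogDD 1 := by
    have hq := lamQuad_pos 1
    have ha : (1 : ℝ) - hexCriticalFugacity ^ 2 ≠ 0 := by linarith
    have c1 : ContinuousAt (fun lam : ℝ => lam ^ 2) 1 := (continuous_pow 2).continuousAt
    have c2 : ContinuousAt (fun lam : ℝ => (lam - hexCriticalFugacity ^ 2) ^ 2) 1 :=
      ((continuous_id.sub continuous_const).pow 2).continuousAt
    have c3 : ContinuousAt (fun lam : ℝ => (lam ^ 2 - hexCriticalFugacity ^ 2 * lam + hexCriticalFugacity ^ 4) ^ 2) 1 :=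
      Continuous.continuousAt (by fun_prop)
    have c4 : ContinuousAt (fun lam : ℝ => 2 * (lam ^ 2 - hexCriticalFugacity ^ 2 * lam + hexCriticalFugacity ^ 4)
        - (2 * lam - hexCriticalFugacity ^ 2) ^ 2) 1 := Continuous.continuousAt (by fun_prop)
    have h1 : (fun lam : ℝ => lam ^ 2) 1 ≠ 0 := by norm_num
    have h2 : (fun lam : ℝ => (lam - hexCriticalFugacity ^ 2) ^ 2) 1 ≠ 0 := pow_ne_zero 2 ha
    have h3 : (fun lam : ℝ => (lam ^ 2 - hexCriticalFugacity ^ 2 * lam + hexCriticalFugacity ^ 4) ^ 2) 1 ≠ 0 := pow_ne_zero 2 hq.ne'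
    show ContinuousAt (fun lam : ℝ => -2 / lam ^ 2 - 1 / (lam - hexCriticalFugacity ^ 2) ^ 2
      - (2 * (lam ^ 2 - hexCriticalFugacity ^ 2 * lam + hexCriticalFugacity ^ 4) - (2 * lam - hexCriticalFugacity ^ 2) ^ 2)
        / (lam ^ 2 - hexCriticalFugacity ^ 2 * lam + hexCriticalFugacity ^ 4) ^ 2) 1
    exact ((continuousAt_const.div c1 h1).sub (continuousAt_const.div c2 h2)).sub (c4.div c3 h3)
  -- values at `1`
  have hS'pos : 0 < tiltLogD 1 := by rw [hS1']; positivity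
  have hf1 : f 1 = 0 := by
    show Real.log 1 - φ * tiltLog 1 = 0
    rw [Real.log_one, hS1, mul_zero, sub_zero]
  have hg1 : g 1 = 0 := by
    show tiltLog 1 * tiltLog 1 = 0
    rw [hS1, mul_zero]
  have ht0 : (1 : ℝ) + 2 * hexCriticalFugacity ^ 2 ≠ 0 := by positivity
  have hf'1 : f' 1 = 0 := by
    show (1 : ℝ)⁻¹ - φ * tiltLogD 1 = 0
    rw [inv_one, hS1', hφ]
    field_simp
    ring
  have hg'1 : g' 1 = 0 := by
    show tiltLogD 1 * tiltLog 1 + tiltLog 1 * tiltLogD 1 = 0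
    rw [hS1, mul_zero, zero_mul, add_zero]
  have hg''1 : g'' 1 = 2 * tiltLogD 1 ^ 2 := by
    show tiltLogDD 1 * tiltLog 1 + tiltLogD 1 * tiltLogD 1 + (tiltLogD 1 * tiltLogD 1 + tiltLog 1 * tiltLogDD 1) = 2 * tiltLogD 1 ^ 2
    rw [hS1]; ring
  have hg''pos : 0 < g'' 1 := by rw [hg''1]; positivity
  -- `g′ ≠ 0` and `g″ ≠ 0` near `1`
  have hg'ne : ∀ᶠ lam in 𝓝[≠] (1 : ℝ), g' lam ≠ 0 := by
    have h1 : ∀ᶠ lam in 𝓝 (1 : ℝ), 0 < tiltLogD lam := cS'.eventually (eventually_gt_nhds hS'pos)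
    have h2 : ∀ᶠ lam in 𝓝[≠] (1 : ℝ), tiltLog lam ≠ 0 := by
      filter_upwards [eventually_nhdsWithin_of_eventually_nhds hU, self_mem_nhdsWithin] with lam hlam hne
      exact tiltLog_ne_zero hlam hne
    filter_upwards [eventually_nhdsWithin_of_eventually_nhds h1, h2] with lam hd hs
    simp only [hg']
    have : tiltLogD lam * tiltLog lam + tiltLog lam * tiltLogD lam = 2 * (tiltLogD lam * tiltLog lam) := by ring
    rw [this]; exact mul_ne_zero two_ne_zero (mul_ne_zero hd.ne' hs)
  have hg''ne : ∀ᶠ lam in 𝓝[≠] (1 : ℝ), g'' lam ≠ 0 := by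
    have cg'' : ContinuousAt g'' 1 := ((cS''.mul cS).add (cS'.mul cS')).add ((cS'.mul cS').add (cS.mul cS''))
    exact eventually_nhdsWithin_of_eventually_nhds ((cg''.eventually (eventually_gt_nhds hg''pos)).mono fun lam h => h.ne')
  -- limits at `1`
  have cf : ContinuousAt f 1 := hff'.self_of_nhds.continuousAt
  have cg : ContinuousAt g 1 := hgg'.self_of_nhds.continuousAt
  have cf' : ContinuousAt f' 1 := hff''.self_of_nhds.continuousAt
  have cg' : ContinuousAt g' 1 := hgg''.self_of_nhds.continuousAt
  have hfa : Tendsto f (𝓝[≠] 1) (𝓝 0) := by rw [← hf1]; exact tendsto_nhdsWithin_of_tendsto_nhds cf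
  have hga : Tendsto g (𝓝[≠] 1) (𝓝 0) := by rw [← hg1]; exact tendsto_nhdsWithin_of_tendsto_nhds cg
  have hfa' : Tendsto f' (𝓝[≠] 1) (𝓝 0) := by rw [← hf'1]; exact tendsto_nhdsWithin_of_tendsto_nhds cf'
  have hga' : Tendsto g' (𝓝[≠] 1) (𝓝 0) := by rw [← hg'1]; exact tendsto_nhdsWithin_of_tendsto_nhds cg'
  -- the value `f″(1)/g″(1) = (96 − 67√2)/8`
  have cf'' : ContinuousAt f'' 1 := by
    simp only [hf'']
    exact ((ContinuousAt.inv₀ (continuousAt_id.pow 2) (by norm_num)).neg).sub (cS''.const_mul φ)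
  have cg'' : ContinuousAt g'' 1 := ((cS''.mul cS).add (cS'.mul cS')).add ((cS'.mul cS').add (cS.mul cS''))
  have hval : f'' 1 / g'' 1 = (96 - 67 * Real.sqrt 2) / 8 := by
    set x := hexCriticalFugacity with hx'
    have ha : (1 : ℝ) - x ^ 2 ≠ 0 := by nlinarith
    have hq' : (1 : ℝ) - x ^ 2 + x ^ 4 ≠ 0 := by nlinarith
    have ht : (1 : ℝ) + 2 * x ^ 2 ≠ 0 := by positivity
    rw [hg''1]
    show (-((1 : ℝ) ^ 2)⁻¹ - φ * tiltLogDD 1) / (2 * tiltLogD 1 ^ 2) = _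
    rw [hS1', hφ, sqrt_two_eq, ← hx', tiltLogDD, ← hx']
    linear_combination (norm := (field_simp; ring))
      (((600 : ℝ) + (-2160 : ℝ) * x ^ 2 + (3680 : ℝ) * x ^ 4 + (-4112 : ℝ) * x ^ 6 + (2672 : ℝ) * x ^ 8 + (-896 : ℝ) * x ^ 10
        + (-64 : ℝ) * x ^ 12 + (64 : ℝ) * x ^ 14) / (128 * ((1 - x ^ 2) * (1 - x ^ 2 + x ^ 4)) ^ 2)) * hP
  have hdiv'' : Tendsto (fun lam => f'' lam / g'' lam) (𝓝[≠] 1) (𝓝 ((96 - 67 * Real.sqrt 2) / 8)) := by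
    rw [← hval]
    exact tendsto_nhdsWithin_of_tendsto_nhds (cf''.div cg'' hg''pos.ne')
  -- l'Hôpital, twice
  have hinner : Tendsto (fun lam => f' lam / g' lam) (𝓝[≠] 1) (𝓝 ((96 - 67 * Real.sqrt 2) / 8)) :=
    HasDerivAt.lhopital_zero_nhdsNE (eventually_nhdsWithin_of_eventually_nhds hff'') (eventually_nhdsWithin_of_eventually_nhds hgg'')
      hg''ne hfa' hga' hdiv''
  have houter := HasDerivAt.lhopital_zero_nhdsNE (eventually_nhdsWithin_of_eventually_nhds hff') (eventually_nhdsWithin_of_eventually_nhds hgg')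
      hg'ne hfa hga hinner
  simpa [hf, hg, pow_two] using houter

end W2

end HV

end Literature.Probability.RandomPlanarGeometry.SAW
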